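import Summits.BirchSwinnertonDyer.BirchSwinnertonDyer.Theorems.ManinLocalTwoThreeCubeSystemDescent
import Summits.BirchSwinnertonDyer.BirchSwinnertonDyer.Theorems.ManinLocalTwoThreeKummerCubeRootThreeBounded
import HarnessLib

/-!
# (INT)_K, the `3`-adic descent read in `ℚ⟦q⟧`: components with a common `ℤ⟦q⟧`-denominator are `3`-adically bounded
(route `ManinLocalTwoThree`, crux C3 `ManinPrimeToThreeAtNine` stmt-BirchSwinnertonDyer-22968; cell bsd-f2-manin, prover seat p3 gen 16 —
piece (INT)_K of -an g39's `K`-rational UDC line, p2 g18's interface; `--supports` 22968)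

`U, V, Θ₁, Θ₂ ∈ ℚ⟦q⟧` with `A·U, A·V ∈ ℤ₃⟦q⟧` for some `A ∈ ℤ⟦q⟧ ∖ 0`, `3ᵉΘ₁, 3ᵉΘ₂ ∈ ℤ₃⟦q⟧`, and the cube system
`U³ + 3rUV² = Θ₁`, `3U²V + rV³ = Θ₂` (`r = 3ᵗr₀`, `3 ∤ r₀`; i.e. `(U + Y V)³ = Θ₁ + Y Θ₂` with `Y² = r`) ⟹ `3^{e+t}U, 3^{e+t}V ∈ ℤ₃⟦q⟧`
(`…CubeSystemDescent.dvd_of_cube_system` in the UFD `ℤ₃⟦q⟧`, where `4` and `r₀` are units).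

* `isPadicInt_of_cube_system` — the statement above (`IsPadicInt` of `Literature.…PadicSeriesEvaluation`).

HONEST FRAMING.  Pure algebra; nothing about (INT)_K's conclusion, C3, Manin's conjecture or BSD is proved here.  No definitions, no sorry.
[folklore]
-/

set_option autoImplicit false
-- lint-debt: the directory name repeats the summit name (sibling precedent `ManinLocalTwoThreeCubeSystemDescent.lean`)
set_option linter.dupNamespace false

noncomputable section

open scoped Classical
open PowerSeries Literature.NumberTheory.EllipticCurves

namespace Summit.BirchSwinnertonDyer.BirchSwinnertonDyer.Theorems.ManinLocalTwoThree.CubeSystemDescent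

/-- `4` is a unit of `ℤ₃⟦q⟧`. [folklore] -/
theorem isUnit_four : IsUnit (4 : ℤ_[3]⟦X⟧) := by
  have h4 : IsUnit ((4 : ℕ) : ℤ_[3]) := by
    rw [PadicInt.isUnit_iff]
    exact PadicInt.norm_natCast_eq_one_iff.mpr (by norm_num)
  have := h4.map (C : ℤ_[3] →+* ℤ_[3]⟦X⟧)
  rwa [Nat.cast_ofNat, map_ofNat] at this

/-- An integer prime to `3` is a unit of `ℤ₃⟦q⟧` (as a constant series). [folklore] -/
theorem isUnit_C_intCast {r₀ : ℤ} (hr₀ : ¬ 3 ∣ r₀) : IsUnit (C (r₀ : ℤ_[3]) : ℤ_[3]⟦X⟧) := by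
  have h : IsUnit (r₀ : ℤ_[3]) := by
    rw [PadicInt.isUnit_iff]
    by_contra hne
    have hlt : ‖(r₀ : ℤ_[3])‖ < 1 := lt_of_le_of_ne (PadicInt.norm_le_one _) hne
    exact hr₀ (PadicInt.norm_int_lt_one_iff_dvd r₀ |>.mp hlt)
  exact h.map (C : ℤ_[3] →+* ℤ_[3]⟦X⟧)

/-- **Components with a common `ℤ⟦q⟧`-denominator satisfying the cube system are `3`-adically bounded.** [folklore] -/
theorem isPadicInt_of_cube_system {U V Θ₁ Θ₂ : ℚ⟦X⟧} {A : ℤ⟦X⟧} (hA : A ≠ 0) {e t : ℕ} {r₀ : ℤ} (hr₀ : ¬ 3 ∣ r₀)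
    (hU : IsPadicInt (PowerSeries.map (algebraMap ℚ ℚ_[3]) (PowerSeries.map (Int.castRingHom ℚ) A * U)))
    (hV : IsPadicInt (PowerSeries.map (algebraMap ℚ ℚ_[3]) (PowerSeries.map (Int.castRingHom ℚ) A * V)))
    (hΘ₁ : IsPadicInt (PowerSeries.map (algebraMap ℚ ℚ_[3]) (C ((3 : ℚ) ^ e) * Θ₁)))
    (hΘ₂ : IsPadicInt (PowerSeries.map (algebraMap ℚ ℚ_[3]) (C ((3 : ℚ) ^ e) * Θ₂)))
    (E1 : U ^ 3 + 3 * C ((3 : ℚ) ^ t * r₀) * U * V ^ 2 = Θ₁) (E2 : 3 * U ^ 2 * V + C ((3 : ℚ) ^ t * r₀) * V ^ 3 = Θ₂) :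
    IsPadicInt (PowerSeries.map (algebraMap ℚ ℚ_[3]) (C ((3 : ℚ) ^ (e + t)) * U)) ∧
      IsPadicInt (PowerSeries.map (algebraMap ℚ ℚ_[3]) (C ((3 : ℚ) ^ (e + t)) * V)) := by
  set ι : ℚ⟦X⟧ →+* ℚ_[3]⟦X⟧ := PowerSeries.map (algebraMap ℚ ℚ_[3]) with hι
  set κ : ℤ_[3]⟦X⟧ →+* ℚ_[3]⟦X⟧ := PowerSeries.map (PadicInt.Coe.ringHom (p := 3)) with hκ
  set ψ : ℤ⟦X⟧ →+* ℤ_[3]⟦X⟧ := PowerSeries.map (Int.castRingHom ℤ_[3]) with hψ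
  set φ : ℤ⟦X⟧ →+* ℚ⟦X⟧ := PowerSeries.map (Int.castRingHom ℚ) with hφ
  have hκinj : Function.Injective κ := PowerSeries.map_injective _ Subtype.val_injective
  have hψinj : Function.Injective ψ := PowerSeries.map_injective _ Int.cast_injective
  have hκint : ∀ G : ℤ_[3]⟦X⟧, IsPadicInt (κ G) := fun G ↦ isPadicInt_iff_exists_powerSeries_map.mpr ⟨G, rfl⟩
  have hικ : ∀ G : ℤ⟦X⟧, ι (φ G) = κ (ψ G) := fun G ↦ by
    rw [hι, hκ, hψ, hφ]
    change ((PowerSeries.map (algebraMap ℚ ℚ_[3])).comp (PowerSeries.map (Int.castRingHom ℚ))) G =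
      ((PowerSeries.map (PadicInt.Coe.ringHom (p := 3))).comp (PowerSeries.map (Int.castRingHom ℤ_[3]))) G
    rw [← PowerSeries.map_comp, ← PowerSeries.map_comp, RingHom.ext_int ((algebraMap ℚ ℚ_[3]).comp (Int.castRingHom ℚ))
      ((PadicInt.Coe.ringHom (p := 3)).comp (Int.castRingHom ℤ_[3]))]
  -- integral models `Bu, Bv, T₁, T₂` and `A₀`
  obtain ⟨Bu, hBu⟩ := isPadicInt_iff_exists_powerSeries_map.mp hU
  obtain ⟨Bv, hBv⟩ := isPadicInt_iff_exists_powerSeries_map.mp hV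
  obtain ⟨T₁, hT₁⟩ := isPadicInt_iff_exists_powerSeries_map.mp hΘ₁
  obtain ⟨T₂, hT₂⟩ := isPadicInt_iff_exists_powerSeries_map.mp hΘ₂
  set A₀ : ℤ_[3]⟦X⟧ := ψ A with hA₀
  have hA₀ne : A₀ ≠ 0 := fun h0 ↦ hA (hψinj (by rw [← hA₀, h0, map_zero]))
  set a : ℚ_[3]⟦X⟧ := κ A₀ with ha
  have haι : ι (φ A) = a := hικ A
  -- scalar bookkeeping
  have hιr : ι (C ((3 : ℚ) ^ t * r₀)) = 3 ^ t * C (r₀ : ℚ_[3]) := by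
    rw [hι, PowerSeries.map_C, map_mul, map_pow, map_intCast, map_ofNat, map_mul, map_pow, map_ofNat]
  have hκr : κ (C (r₀ : ℤ_[3])) = C (r₀ : ℚ_[3]) := by
    rw [hκ, PowerSeries.map_C, PadicInt.Coe.ringHom_apply, PadicInt.coe_intCast]
  have hι3 : ∀ n : ℕ, ι (C ((3 : ℚ) ^ n)) = 3 ^ n := fun n ↦ by rw [hι, PowerSeries.map_C, map_pow, map_ofNat, map_pow, map_ofNat]
  -- images of the data
  have eU : κ Bu = a * ι U := by rw [hBu, map_mul, haι]
  have eV : κ Bv = a * ι V := by rw [hBv, map_mul, haι]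
  have eT₁ : κ T₁ = 3 ^ e * ι Θ₁ := by rw [hT₁, map_mul, hι3]
  have eT₂ : κ T₂ = 3 ^ e * ι Θ₂ := by rw [hT₂, map_mul, hι3]
  have iE1 := congrArg ι E1
  have iE2 := congrArg ι E2
  rw [map_add, map_mul, map_mul, map_mul, map_pow, map_pow, hιr, map_ofNat] at iE1
  rw [map_add, map_mul, map_mul, map_mul, map_pow, map_pow, hιr, map_ofNat] at iE2
  -- the cube system in `ℤ₃⟦q⟧`
  have hE1 : 3 ^ e * (Bu ^ 3 + 3 * (3 ^ t * C (r₀ : ℤ_[3])) * Bu * Bv ^ 2) = A₀ ^ 3 * T₁ := by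
    apply hκinj
    simp only [map_mul, map_add, map_pow, map_ofNat, hκr, eU, eV, eT₁, ← ha]
    linear_combination (3 ^ e * a ^ 3) * iE1
  have hE2 : 3 ^ e * (3 * Bu ^ 2 * Bv + (3 ^ t * C (r₀ : ℤ_[3])) * Bv ^ 3) = A₀ ^ 3 * T₂ := by
    apply hκinj
    simp only [map_mul, map_add, map_pow, map_ofNat, hκr, eU, eV, eT₂, ← ha]
    linear_combination (3 ^ e * a ^ 3) * iE2
  obtain ⟨⟨Wu, hWu⟩, ⟨Wv, hWv⟩⟩ := dvd_of_cube_system isUnit_four (isUnit_C_intCast hr₀) hA₀ne hE1 hE2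
  -- read back in `ℚ⟦q⟧`
  have hane : a ≠ 0 := fun h0 ↦ hA₀ne (hκinj (by rw [← ha, h0, map_zero]))
  have keyU : ι (C ((3 : ℚ) ^ (e + t)) * U) = κ Wu := by
    have h1 : a * ι (C ((3 : ℚ) ^ (e + t)) * U) = a * κ Wu := by
      rw [map_mul, hι3, ha, ← map_mul, ← hWu, map_mul, map_pow, map_ofNat, ← ha, eU]; ring
    exact mul_left_cancel₀ hane h1
  have keyV : ι (C ((3 : ℚ) ^ (e + t)) * V) = κ Wv := by
    have h1 : a * ι (C ((3 : ℚ) ^ (e + t)) * V) = a * κ Wv := by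
      rw [map_mul, hι3, ha, ← map_mul, ← hWv, map_mul, map_pow, map_ofNat, ← ha, eV]; ring
    exact mul_left_cancel₀ hane h1
  exact ⟨by rw [keyU]; exact hκint Wu, by rw [keyV]; exact hκint Wv⟩

end Summit.BirchSwinnertonDyer.BirchSwinnertonDyer.Theorems.ManinLocalTwoThree.CubeSystemDescent

end
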